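import Summits.QuantumFields.YangMills.Theorems.BalabanUVNodesN20CoreEdgeShellDial
import Summits.QuantumFields.YangMills.Theorems.BalabanUVNodesSpineReadingOfRecord13CoPHKTower

/-!
# BalabanUVNodes ∕ N20 (NE7b) — the `hedge`-JOINT COMPANION, module 13K: THE SHELL DIAL AT A KEY READING, AND THE ℓ¹ MATCHING LETTER DESCENDS ALONG THE
# KEY DIAL — at dag-n20-d's key-reading edition `crOfRecord₁₃KAt K₀ kr bd sh` the ℓ¹-optimal shells again make the N19′ core edge FREE (every `kr`, every `bd`),
# and the located two-run content of the (N19′, N21) pair, «summable one-sided ℓ¹ class-mismatch modulo constants», is MONOTONE NON-INCREASING along every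
# coarsening of the key, in particular along the window tower `windowKeyReading₁₃ K₀ c`, floor `c ≤ c′` (same constants, same fraction, no structural letter)

Cell `pub-ymgap` (HUMAN RULING D-0062 Track A; D-0149 width push), seat `pub-ymgap-dag-n20-w3` (WIDTH SEAT 3 of 3 on NODE n20 = NE7b) gen 6, CLAIM-1 ∕ INTENT-1
(pub-ymgap INBOX l.31242).  Filed `--kind proof --supports stmt-QuantumFields-20544 --as helper` (K3⁷ `SpineGivenEndpointR13SepCoPH`; skeleton v5 941dddb108cbaacf);
COUNT-NEUTRAL.  ADDITIVE — imports this lineage's module 13 `…N20CoreEdgeShellDial` (gen 5, p608626: `core_optShell_zero`, `shellWeightBound_optShell`,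
`hybridNE7_optShell_of_l1Mismatch`, `posPart_sub_exp_mul_le`) and dag-n20-d's `…SpineReadingOfRecord13CoPHKTower` (p610265; through it the K edition p608328:
`crOfRecord₁₃KAt`, `classSetK₁₃`, `weightAK₁₃ ∕ weightBK₁₃`, `kr_mem_classSetK₁₃`, `weightAK₁₃_nonneg`, `core_crOfRecord₁₃KAt`, `shellWeightBound_crOfRecord₁₃KAt`,
`windowKeyReading₁₃`, `weightAK₁₃_window_of_le`, `classSetK₁₃_window_of_le`); node U5d's `fiberSum` ∕ `classVal` BY NAME; modifies nothing.
[III] = [Balaban1988Convergent], [LF-I∕II] = [Balaban1989LargeFieldI∕II], [King1986] = CMP 102.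

WHY.  Module 13 located, at v5's PINNED key (`crOfRecord₁₃VAt`, identity dial), that with the shell split `sh` free the ℓ¹-optimal shells `shA⋆ = (A − e^{−c}B)⁺`,
`shB⋆ = (B − e^{c}A)⁺` make the N19′ conjunct hold outright and move the whole two-run content of the (N19′, N21) pair into ONE letter: the one-sided ℓ¹ mismatch
fractions `Σ_T (A − e^{−c_K}B)⁺ ≤ w_K·Σ_T A`, `Σ_T (B − e^{c_K}A)⁺ ≤ w_K·Σ_T B`, `w` summable.  Plan g83 booked for K3⁷ v6 BOTH a shell pin (WORDS-3 (5)) AND a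
KEY-READING dial with value `kr := wkey` (WORDS-3 (D) ∕ WORDS-4 «re-key the core law at the window key»), and dag-n20-d has declared the object such a dial pins to,
`crOfRecord₁₃KAt K₀ kr bd sh` (the record's fine class weights partially summed along a per-tuple coarsening `kr` of the σ-packed key; bad class read by `bd` at the
coarse key), with its window value and the tower of windows.  Two design questions are answered here in the kernel:
* (i) DOES A KEY PIN RESTORE THE N19′∕N21 DIVISION OF LABOUR?  No: §2 ★★★ `core_crOfRecord₁₃KAt_optShell` — at EVERY key reading and EVERY bad reading the N19′ pair
  `Core … (cr).δ ∧ Summable (cr).δ` holds OUTRIGHT at the ℓ¹-optimal split of the COARSE weights (the degeneracy belongs to the free shell dial, not to the identity key);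
  N21 there is again the one ℓ¹ letter, on the coarse weights (★★ `shellWeightBound_crOfRecord₁₃KAt_optShell_of_l1MismatchK`).
* (ii) WHAT DOES COARSENING DO TO THAT LETTER?  It can only make it CHEAPER, loss-free: §1 ★★ `sum_posPart_classVal_sub_mul_le` — the one-sided ℓ¹ mismatch at a
  constant is SUBADDITIVE under partial summation, `Σ_{T K} (classVal p − m·classVal q)⁺ ≤ Σ_{S K} (p − m·q)⁺` (mismatches of opposite sign inside a merged class cancel
  for free), totals preserved (`sum_classVal`).  Hence ★★★ `shellWeightBound_crOfRecord₁₃KAt_optShell_of_l1Mismatch`: module 13's letter AT THE RECORD's fine weights —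
  verbatim the hypotheses of its `shellWeightBound_crOfRecord₁₃VAt_optShell_of_l1Mismatch` — serves the N21 face at EVERY key reading, same `c`, same `w`; and along the
  key-reading towers (§3 ★★★ `mismatch_comp_of_mismatch` ∕ `mismatch_window_of_le`): the letter at `kr₁` implies the letter at `kr₂ ∘ kr₁`; floors `c ≤ c′` likewise.  Also: re-keying
  SHRINKS the optimal shells pointwise (★ `posPart_fiberSum_sub_mul_le`), and a two-class toy where the descent is STRICT (`toy_fine_mismatchA_ge` ∕
  `toy_coarse_mismatch_eq_zero`: the fine letter needs `w ≥ ½` at every constant, the coarse one holds with `w = 0`) — descent is not ascent.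
LOCATED (for plan g84 ∕ the n19 ∕ n21 lanes; said, not decided): along the window tower floor `0` (v5's pin = the full σ-packed (2.18) history) → floor `c` → floor
`c′` → top floor («nothing old keyed») the invariant two-run content of stub 2's (N19′, N21) pair is MONOTONE NON-INCREASING IN THE FLOOR and its descent costs NO
structural letter — contrast `NE7.Core`, a sup-statement over classes, whose descent along `classVal` dag-n19-w1 prices by class-factor ∕ absorption letters (p610409
(D)); the ℓ¹ letter is additive and descends by `x ↦ x⁺` subadditivity alone.  So the window road of `Cruxes/SpineGivenEndpointR13SepCoPH/Ideas/window-key-core.md`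
LOWERS the (N19′, N21) bill monotonically; the price of coarsening sits entirely on the OTHER sides — the ascent back to a finer key (dag-n19-w1's `Fib`, p601591 ∕
p604222) and N20's booking of over-aged regions at the coarse key (card (AC); dag-n20-w2's `…N20KeyedRelWeightAtKeyReading`).  With `sh` free a `kr` pin alone leaves
the N19′∕N21 division degenerate; a shell pin at a coarse key would read dag-n21-d's indicator split `shellSplitOfRecord₁₃At …` through its `classVal` push-forward —
no such object is in the tree and none is introduced here (declarer lanes n21-d ∕ n20-d).

HONEST FRAMING.  [folklore] finite-sum ∕ `max` ∕ `exp` arithmetic over the tree's SHAPES (`NE7.Core`, `ShellWeightBound`, `HybridNE7`, `RelWeightBound`) and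
dag-n20-d's K edition BY NAME; count-neutral; proves NO estimate of the programme: every ℓ¹ letter below is a HYPOTHESIS, inhabited for no Bałaban family today (A2
declared) — as a statement it is the two-run UV-stability content of NE7 ∕ NE7c at the keyed classes, NOT PRINTED for `d = 4`, NOT proved; the
hypothesis-free results (§2 ★★★ core, §1 shrinking) book NOTHING about Bałaban's objects beyond `0 ≤` class weights.  Nothing of Bałaban's asserted; no
`Provisos₁₃CoPH` inhabitant claimed (K0⁷ OPEN); NE7 ∕ NE7b ∕ NE7c NOT PRINTED ∕ NOT PROVED; N19 ∕ N20 ∕ N21 NOT discharged; K3⁷ NOT closed, not claimed, v5 STANDS; counts unmoved (typed 28∕28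
· discharged 5∕28); no count claim.  One finite `𝕋⁴_{L^K}` programme at fixed `ε = L^{−K}`, Bałaban AS PRINTED; the YM mass gap (Clay) is NOT proved by any of this —
R4 closes the conditional finite-𝕋⁴ rung `BalabanLadder.UV` only; NOT ℝ⁴, NOT continuum, NOT OS.  No `def`, no `instance`, no `notation`, no `sorry`, no private
decls.  Sources (location only): [King1986] (3.10)–(3.13) pp.656–657; [LF-I] p.193 (indicator shells); [LF-II] (1.80) p.384 (the window); [III] (2.18) p.257.
-/

noncomputable section

open Finset
open scoped BigOperators

namespace Summit.QuantumFields.YangMills.BalabanUVNodes.N20CoreEdgeShellDialAtKeyReading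

open Literature.MathematicalPhysics.QuantumFieldTheory.Balaban1983to89
open Literature.MathematicalPhysics.QuantumFieldTheory.Balaban1983to89.T4Continuum
open Literature.MathematicalPhysics.QuantumFieldTheory.Balaban1983to89.Node00
open T4WeightBudget (RelWeightBound)
open T4IndicatorShell (ShellWeightBound)
open T4MatchingAssembly (HybridNE7 classVal sum_classVal classVal_nonneg)
open T4HybridMatching (fiberSum sum_fiberSum)
open Summit.QuantumFields.BalabanUV.T4Continuum.Spine YMDAG.UVSplit
open Summit.QuantumFields.YangMills.BalabanUVNodes.N21KeyedShellWeightShellZero (weightA₁₃_nonneg weightB₁₃_nonneg)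
open Summit.QuantumFields.YangMills.BalabanUVNodes.N20CoreEdgeShellDial

/-! ## §1 Abstract: the one-sided ℓ¹ mismatch at a constant CONTRACTS under partial summation (node U5d's `fiberSum` ∕ `classVal`) -/

/-- `(Σ_S f)⁺ ≤ Σ_S f⁺` — the positive part is subadditive over a finite sum. [folklore] -/
theorem posPart_sum_le_sum_posPart {σ : Type*} (S : Finset σ) (f : σ → ℝ) : max 0 (∑ s ∈ S, f s) ≤ ∑ s ∈ S, max 0 (f s) :=
  max_le (Finset.sum_nonneg fun _ _ => le_max_left _ _) (Finset.sum_le_sum fun _ _ => le_max_right _ _)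

section Fibre

variable {σ ι : Type*} [DecidableEq ι]

/-- **★ RE-KEYING ONLY SHRINKS THE ℓ¹-OPTIMAL SHELLS**: at a coarse class `τ` the optimal shell of the COARSE weights, `(fiberSum b − m·fiberSum a)⁺`, is at most the fibre
sum of the fine optimal shells `(b − m·a)⁺` — node U5d's fibre sum is linear and mismatches of opposite sign inside the merged class cancel for free. [folklore] -/
theorem posPart_fiberSum_sub_mul_le (S : Finset σ) (π : σ → ι) (a b : σ → ℝ) (m : ℝ) (τ : ι) :
    max 0 (fiberSum S π b τ - m * fiberSum S π a τ) ≤ fiberSum S π (fun s => max 0 (b s - m * a s)) τ := by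
  unfold fiberSum
  rw [Finset.mul_sum, ← Finset.sum_sub_distrib]
  exact posPart_sum_le_sum_posPart _ _

/-- **THE ONE-SIDED ℓ¹ MISMATCH AT A CONSTANT CONTRACTS UNDER PARTIAL SUMMATION**: `Σ_{τ ∈ T} (fiberSum b − m·fiberSum a)⁺ ≤ Σ_{s ∈ S} (b − m·a)⁺` whenever `π` maps `S`
into `T` (sum the shrinking over the coarse classes; `sum_fiberSum`). [folklore] -/
theorem sum_posPart_fiberSum_sub_mul_le {S : Finset σ} {T : Finset ι} {π : σ → ι} (a b : σ → ℝ) (m : ℝ) (hmaps : ∀ s ∈ S, π s ∈ T) :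
    ∑ τ ∈ T, max 0 (fiberSum S π b τ - m * fiberSum S π a τ) ≤ ∑ s ∈ S, max 0 (b s - m * a s) :=
  calc ∑ τ ∈ T, max 0 (fiberSum S π b τ - m * fiberSum S π a τ)
      ≤ ∑ τ ∈ T, fiberSum S π (fun s => max 0 (b s - m * a s)) τ := Finset.sum_le_sum fun τ _ => posPart_fiberSum_sub_mul_le S π a b m τ
    _ = ∑ s ∈ S, max 0 (b s - m * a s) := sum_fiberSum _ hmaps

variable {l₀ vol : ℝ} {S : ℕ → Finset σ} {T : ℕ → Finset ι} {π : ℕ → σ → ι} {a b : ℕ → ℝ → σ → ℝ}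

/-- In the spine currency (`K`, `t`): re-keying along `classVal S π` only shrinks the optimal shells (run-generic: `p` against `m·q`). [folklore] -/
theorem optShell_classVal_le_classVal_optShell (p q : ℕ → ℝ → σ → ℝ) (m : ℝ) (K : ℕ) (t : ℝ) (τ : ι) :
    max 0 (classVal S π p K t τ - m * classVal S π q K t τ) ≤ classVal S π (fun K t s => max 0 (p K t s - m * q K t s)) K t τ :=
  posPart_fiberSum_sub_mul_le (S K) (π K) (q K t) (p K t) m τ

/-- **★★ THE ONE-SIDED ℓ¹ MISMATCH AT A CONSTANT CONTRACTS ALONG `classVal`**: `Σ_{T K} (classVal p − m·classVal q)⁺ ≤ Σ_{S K} (p − m·q)⁺` (`hmaps` only). [folklore] -/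
theorem sum_posPart_classVal_sub_mul_le (hmaps : ∀ K, ∀ s ∈ S K, π K s ∈ T K) (p q : ℕ → ℝ → σ → ℝ) (m : ℝ) (K : ℕ) (t : ℝ) :
    ∑ τ ∈ T K, max 0 (classVal S π p K t τ - m * classVal S π q K t τ) ≤ ∑ s ∈ S K, max 0 (p K t s - m * q K t s) :=
  sum_posPart_fiberSum_sub_mul_le (q K t) (p K t) m (hmaps K)

/-- **★★ THE ℓ¹ MISMATCH LETTER DESCENDS, SAME CONSTANT, SAME FRACTION**: if at `(K, t)` the fine mismatch `Σ_{S K} (p − m·q)⁺ ≤ w·Σ_{S K} p`, then at the coarse carriers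
`Σ_{T K} (classVal p − m·classVal q)⁺ ≤ w·Σ_{T K} classVal p` (totals preserved, `sum_classVal`).  Run A's letter of module 13 is `(p, q, m) = (A, B, e^{−c_K})`, run B's is
`(B, A, e^{c_K})`. [folklore] -/
theorem mismatch_classVal_le_of_mismatch_le (hmaps : ∀ K, ∀ s ∈ S K, π K s ∈ T K) {p q : ℕ → ℝ → σ → ℝ} {m w : ℝ} {K : ℕ} {t : ℝ}
    (h : ∑ s ∈ S K, max 0 (p K t s - m * q K t s) ≤ w * ∑ s ∈ S K, p K t s) :
    ∑ τ ∈ T K, max 0 (classVal S π p K t τ - m * classVal S π q K t τ) ≤ w * ∑ τ ∈ T K, classVal S π p K t τ :=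
  calc ∑ τ ∈ T K, max 0 (classVal S π p K t τ - m * classVal S π q K t τ)
      ≤ ∑ s ∈ S K, max 0 (p K t s - m * q K t s) := sum_posPart_classVal_sub_mul_le hmaps p q m K t
    _ ≤ w * ∑ s ∈ S K, p K t s := h
    _ = w * ∑ τ ∈ T K, classVal S π p K t τ := by rw [sum_classVal (b := p) (hmaps K) t]

/-- **★★ N21's SHAPE AT THE COARSE CARRIERS WITH THEIR OWN ℓ¹-OPTIMAL SHELLS, FROM THE FINE LETTER**: non-negative fine weights, module 13's two mismatch letters at
`(S, a, b)` with constants `c` and summable fraction `w ≥ 0` ⇒ `ShellWeightBound l₀ T (classVal a) (classVal b) shA⋆ shB⋆ w` where `sh⋆` are the optimal shells OF THE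
COARSE weights (module 13's `shellWeightBound_optShell` BY NAME on the descended letters).  The hypothesis IS the two-run matching content — NOT PRINTED for `d = 4`, NOT proved.
[cite: Balaban1989LargeFieldI, p.193 (indicator-shell template only)] [folklore] -/
theorem shellWeightBound_optShell_classVal_of_l1Mismatch (hmaps : ∀ K, ∀ s ∈ S K, π K s ∈ T K) (c : ℕ → ℝ) {w : ℕ → ℝ}
    (ha : ∀ (K : ℕ) (t : ℝ), |t| ≤ l₀ → ∀ s ∈ S K, 0 ≤ a K t s) (hb : ∀ (K : ℕ) (t : ℝ), |t| ≤ l₀ → ∀ s ∈ S K, 0 ≤ b K t s)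
    (hw0 : ∀ K, 0 ≤ w K) (hws : Summable w)
    (hmA : ∀ (K : ℕ) (t : ℝ), |t| ≤ l₀ → ∑ s ∈ S K, max 0 (a K t s - Real.exp (-c K) * b K t s) ≤ w K * ∑ s ∈ S K, a K t s)
    (hmB : ∀ (K : ℕ) (t : ℝ), |t| ≤ l₀ → ∑ s ∈ S K, max 0 (b K t s - Real.exp (c K) * a K t s) ≤ w K * ∑ s ∈ S K, b K t s) :
    ShellWeightBound l₀ T (classVal S π a) (classVal S π b)
      (fun K t τ => max 0 (classVal S π a K t τ - Real.exp (-c K) * classVal S π b K t τ))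
      (fun K t τ => max 0 (classVal S π b K t τ - Real.exp (c K) * classVal S π a K t τ)) w :=
  shellWeightBound_optShell (classVal S π a) (classVal S π b) c (fun K t ht τ _ => classVal_nonneg (ha K t ht) τ)
    (fun K t ht τ _ => classVal_nonneg (hb K t ht) τ) hw0 hws (fun K t ht => mismatch_classVal_le_of_mismatch_le hmaps (hmA K t ht))
    (fun K t ht => mismatch_classVal_le_of_mismatch_le hmaps (hmB K t ht))

/-- N19′'s `Core` at the coarse carriers with their own optimal shells, radius zero, ANY bad class — module 13's `core_optShell_zero` (no letter needed). [folklore] -/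
theorem core_optShell_classVal_zero {Bad : ℕ → ℝ → Finset ι} (c : ℕ → ℝ)
    (ha : ∀ (K : ℕ) (t : ℝ), |t| ≤ l₀ → ∀ s ∈ S K, 0 ≤ a K t s) (hb : ∀ (K : ℕ) (t : ℝ), |t| ≤ l₀ → ∀ s ∈ S K, 0 ≤ b K t s) :
    NE7.Core l₀ vol T Bad (fun K t τ => classVal S π a K t τ - max 0 (classVal S π a K t τ - Real.exp (-c K) * classVal S π b K t τ))
      (fun K t τ => classVal S π b K t τ - max 0 (classVal S π b K t τ - Real.exp (c K) * classVal S π a K t τ)) (fun _ => 0) :=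
  core_optShell_zero (classVal S π a) (classVal S π b) c (fun K t ht τ _ => classVal_nonneg (ha K t ht) τ)
    (fun K t ht τ _ => classVal_nonneg (hb K t ht) τ)

/-- **★ THE HYBRID AT THE COARSE CARRIERS FROM THE FINE LETTER** (module 13's `hybridNE7_optShell_of_l1Mismatch` BY NAME): NE7b's `RelWeightBound` at the coarse carriers
(any `Bad`, `W`), the fine ℓ¹ letters, `W + w < 1` ⇒ `HybridNE7 l₀ vol T (classVal a) (classVal b) Bad W shA⋆ shB⋆ w 0` — node U5's exit `NE7.target_of_hybridNE7` applies
at ANY key (the hybrid is index-agnostic). [cite: King1986, (3.10)–(3.13) pp.656–657 (template only)] [folklore] -/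
theorem hybridNE7_optShell_classVal_of_l1Mismatch {Bad : ℕ → ℝ → Finset ι} {W w : ℕ → ℝ} (hmaps : ∀ K, ∀ s ∈ S K, π K s ∈ T K) (c : ℕ → ℝ)
    (hW : RelWeightBound l₀ T (classVal S π a) (classVal S π b) Bad W)
    (ha : ∀ (K : ℕ) (t : ℝ), |t| ≤ l₀ → ∀ s ∈ S K, 0 ≤ a K t s) (hb : ∀ (K : ℕ) (t : ℝ), |t| ≤ l₀ → ∀ s ∈ S K, 0 ≤ b K t s)
    (hw0 : ∀ K, 0 ≤ w K) (hws : Summable w)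
    (hmA : ∀ (K : ℕ) (t : ℝ), |t| ≤ l₀ → ∑ s ∈ S K, max 0 (a K t s - Real.exp (-c K) * b K t s) ≤ w K * ∑ s ∈ S K, a K t s)
    (hmB : ∀ (K : ℕ) (t : ℝ), |t| ≤ l₀ → ∑ s ∈ S K, max 0 (b K t s - Real.exp (c K) * a K t s) ≤ w K * ∑ s ∈ S K, b K t s)
    (hlt : ∀ K, W K + w K < 1) :
    HybridNE7 l₀ vol T (classVal S π a) (classVal S π b) Bad W
      (fun K t τ => max 0 (classVal S π a K t τ - Real.exp (-c K) * classVal S π b K t τ))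
      (fun K t τ => max 0 (classVal S π b K t τ - Real.exp (c K) * classVal S π a K t τ)) w (fun _ => 0) :=
  hybridNE7_optShell_of_l1Mismatch (classVal S π a) (classVal S π b) c hW (fun K t ht τ _ => classVal_nonneg (ha K t ht) τ)
    (fun K t ht τ _ => classVal_nonneg (hb K t ht) τ) hw0 hws (fun K t ht => mismatch_classVal_le_of_mismatch_le hmaps (hmA K t ht))
    (fun K t ht => mismatch_classVal_le_of_mismatch_le hmaps (hmB K t ht)) hlt

end Fibre

/-! ### §1b Toy: the descent is STRICT (two fine classes `s ∈ Bool` read to one coarse class; run A `(1, 1)`, run B `(2, 0)`) -/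

section Toy

/-- TOY, fine key: run A's one-sided mismatch at ANY constant `c` is `≥ 1 = ½·Σ a` (the class `s = true` carries `b = 0`, so its whole A-weight is unmatched) — the fine
letter needs `w ≥ ½`. [folklore] -/
theorem toy_fine_mismatchA_ge (c : ℝ) :
    (1 : ℝ) ≤ ∑ s ∈ (Finset.univ : Finset Bool), max 0 ((fun _ : Bool => (1 : ℝ)) s - Real.exp (-c) * (fun s : Bool => if s then (0 : ℝ) else 2) s) := by
  have h2 : 0 ≤ max 0 ((fun _ : Bool => (1 : ℝ)) false - Real.exp (-c) * (fun s : Bool => if s then (0 : ℝ) else 2) false) := le_max_left _ _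
  have hs := Fintype.sum_bool fun s : Bool => max 0 ((fun _ : Bool => (1 : ℝ)) s - Real.exp (-c) * (fun s : Bool => if s then (0 : ℝ) else 2) s)
  simp only [if_true, mul_zero, sub_zero, max_eq_right (zero_le_one : (0 : ℝ) ≤ 1)] at hs h2 ⊢
  linarith

/-- TOY, coarse key (everything read to the one class `()`): both coarse weights are `2`, so at `c = 0` BOTH optimal shells `(2 − e^{0}·2)⁺` VANISH — the coarse letter
holds with `w = 0` where the fine one needs `w ≥ ½`: the descent of §1 is strict, and not an ascent. [folklore] -/
theorem toy_coarse_mismatch_eq_zero :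
    fiberSum (Finset.univ : Finset Bool) (fun _ => ()) (fun _ => (1 : ℝ)) () = 2 ∧
    fiberSum (Finset.univ : Finset Bool) (fun _ => ()) (fun s => if s then (0 : ℝ) else 2) () = 2 ∧ max 0 ((2 : ℝ) - Real.exp 0 * 2) = 0 := by
  refine ⟨?_, ?_, by rw [Real.exp_zero]; norm_num⟩ <;> unfold fiberSum <;> rw [Finset.filter_true_of_mem fun _ _ => rfl, Fintype.sum_bool] <;> norm_num

end Toy

/-! ## §2 At dag-n20-d's key-reading edition `crOfRecord₁₃KAt K₀ kr bd sh⋆` — every key reading `kr`, every bad reading `bd`, every offset, tuple, `g₀`, `os` -/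

section Record

variable {F : T4Family} {N : ℕ} [NeZero N]

/-- **THE ℓ¹-OPTIMAL SHELL SPLIT OF THE COARSE WEIGHTS EXISTS AS A `ShellSplit₁₃CoPH`**: for every key reading `kr` and constant reading `cK` there is `sh⋆` with
`sh⋆ F θ hP g₀ os = ((weightAK₁₃ − e^{−c}·weightBK₁₃)⁺, (weightBK₁₃ − e^{c}·weightAK₁₃)⁺)` at the tuple's coarse key `kr F θ hP g₀ os` and `c := cK F θ hP g₀ os`
(∃-form, so that no `def` is introduced). [bookkeeping] -/
theorem exists_optShellSplitK (K₀ : ℕ) (kr : KeyReading₁₃ N K₀)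
    (cK : (F : T4Family) → (θ : Stage13HParams F N) → θ.Provisos₁₃CoPH F N → (ℕ → ℝ) → List (ULoop F) → ℕ → ℝ) :
    ∃ sh : ShellSplit₁₃CoPH N K₀, ∀ (F : T4Family) (θ : Stage13HParams F N) (hP : θ.Provisos₁₃CoPH F N) (g₀ : ℕ → ℝ) (os : List (ULoop F)),
      sh F θ hP g₀ os =
        (fun K t u => max 0 (weightAK₁₃ θ hP K₀ g₀ os (kr F θ hP g₀ os) K t u - Real.exp (-cK F θ hP g₀ os K) * weightBK₁₃ θ hP K₀ g₀ os (kr F θ hP g₀ os) K t u),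
         fun K t u => max 0 (weightBK₁₃ θ hP K₀ g₀ os (kr F θ hP g₀ os) K t u - Real.exp (cK F θ hP g₀ os K) * weightAK₁₃ θ hP K₀ g₀ os (kr F θ hP g₀ os) K t u)) :=
  ⟨fun F θ hP g₀ os =>
    (fun K t u => max 0 (weightAK₁₃ θ hP K₀ g₀ os (kr F θ hP g₀ os) K t u - Real.exp (-cK F θ hP g₀ os K) * weightBK₁₃ θ hP K₀ g₀ os (kr F θ hP g₀ os) K t u),
     fun K t u => max 0 (weightBK₁₃ θ hP K₀ g₀ os (kr F θ hP g₀ os) K t u - Real.exp (cK F θ hP g₀ os K) * weightAK₁₃ θ hP K₀ g₀ os (kr F θ hP g₀ os) K t u)),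
    fun _ _ _ _ _ => rfl⟩

variable (K₀ : ℕ) (kr : KeyReading₁₃ N K₀) (bd : BadKeyReading₁₃ N K₀) (sh : ShellSplit₁₃CoPH N K₀) (θ : Stage13HParams F N) (hP : θ.Provisos₁₃CoPH F N)
  (g₀ : ℕ → ℝ) (os : List (ULoop F)) (c : ℕ → ℝ)
  /- the displayed row «`sh` reads, at this tuple, the ℓ¹-optimal split of the COARSE weights at the constants `c`» (a witness: `exists_optShellSplitK`) -/
  (hsh : sh F θ hP g₀ os =
    (fun K t u => max 0 (weightAK₁₃ θ hP K₀ g₀ os (kr F θ hP g₀ os) K t u - Real.exp (-c K) * weightBK₁₃ θ hP K₀ g₀ os (kr F θ hP g₀ os) K t u),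
     fun K t u => max 0 (weightBK₁₃ θ hP K₀ g₀ os (kr F θ hP g₀ os) K t u - Real.exp (c K) * weightAK₁₃ θ hP K₀ g₀ os (kr F θ hP g₀ os) K t u)))

/-- Run A's coarse class weight is non-negative at every Stage-13 tuple with core provisos, every dial, step, source, key (dag-n20-d's transport of dag-n20-w2's
`weightA₁₃_nonneg`). [bookkeeping] -/
theorem weightAK₁₃_nonneg_record (K : ℕ) (t : ℝ) (u : Σ K, SiteSeqKey F (K₀ + K)) : 0 ≤ weightAK₁₃ θ hP K₀ g₀ os (kr F θ hP g₀ os) K t u :=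
  weightAK₁₃_nonneg θ hP K₀ g₀ os (kr F θ hP g₀ os) (fun x _ => weightA₁₃_nonneg F θ hP K₀ g₀ os K t x) u

/-- Run B, likewise. [bookkeeping] -/
theorem weightBK₁₃_nonneg_record (K : ℕ) (t : ℝ) (u : Σ K, SiteSeqKey F (K₀ + K)) : 0 ≤ weightBK₁₃ θ hP K₀ g₀ os (kr F θ hP g₀ os) K t u :=
  weightBK₁₃_nonneg θ hP K₀ g₀ os (kr F θ hP g₀ os) (fun x _ => weightB₁₃_nonneg F θ hP K₀ g₀ os K t x) u

include hsh in
/-- **★★★ N19′'s PAIR AT THE KEY-READING EDITION WITH THE ℓ¹-OPTIMAL SHELLS HOLDS OUTRIGHT — EVERY KEY READING `kr`, EVERY BAD READING `bd`**: `NE7.Core` at the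
reading's own canonical rate `(cr).δ` AND `Summable (cr).δ` at `cr := crOfRecord₁₃KAt K₀ kr bd sh⋆ F θ hP g₀ os`, every offset, tuple with core provisos, `g₀`, `os`, `c`
(dag-n20-d's `core_crOfRecord₁₃KAt` on module 13's `core_optShell_zero`).  Module 13's degeneracy is thus a property of the free SHELL dial at ANY key, not of v5's identity
pin: a key-reading pin alone does not restore the N19′∕N21 division of labour. [cite: King1986, (3.10)–(3.13) pp.656–657 (template only)] [bookkeeping] -/
theorem core_crOfRecord₁₃KAt_optShell :
    (letI := (crOfRecord₁₃KAt K₀ kr bd sh F θ hP g₀ os).dec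
     NE7.Core (crOfRecord₁₃KAt K₀ kr bd sh F θ hP g₀ os).l₀ (crOfRecord₁₃KAt K₀ kr bd sh F θ hP g₀ os).vol (crOfRecord₁₃KAt K₀ kr bd sh F θ hP g₀ os).T
      (crOfRecord₁₃KAt K₀ kr bd sh F θ hP g₀ os).Bad
      (fun K t τ => (crOfRecord₁₃KAt K₀ kr bd sh F θ hP g₀ os).A K t τ - (crOfRecord₁₃KAt K₀ kr bd sh F θ hP g₀ os).shA K t τ)
      (fun K t τ => (crOfRecord₁₃KAt K₀ kr bd sh F θ hP g₀ os).B K t τ - (crOfRecord₁₃KAt K₀ kr bd sh F θ hP g₀ os).shB K t τ)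
      (crOfRecord₁₃KAt K₀ kr bd sh F θ hP g₀ os).δ) ∧ Summable (crOfRecord₁₃KAt K₀ kr bd sh F θ hP g₀ os).δ := by
  letI : DecidableEq (Σ K, SiteSeqKey F (K₀ + K)) := Classical.decEq _
  have hA := weightAK₁₃_nonneg_record K₀ kr θ hP g₀ os
  have hB := weightBK₁₃_nonneg_record K₀ kr θ hP g₀ os
  refine core_crOfRecord₁₃KAt K₀ kr bd sh θ hP g₀ os (δ := fun _ => 0) ?_ ?_ summable_zero
  · intro K t _ u _
    rw [hsh]
    exact sub_nonneg.mpr (posPart_sub_exp_mul_le (-c K) (hA K t u) (hB K t u))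
  · rw [hsh]
    exact core_optShell_zero (l₀ := 1) (T := classSetK₁₃ θ K₀ g₀ (kr F θ hP g₀ os))
      (Bad := badClassK₁₃ θ K₀ g₀ (kr F θ hP g₀ os) (bd F θ hP g₀ os))
      (weightAK₁₃ θ hP K₀ g₀ os (kr F θ hP g₀ os)) (weightBK₁₃ θ hP K₀ g₀ os (kr F θ hP g₀ os)) c
      (fun K t _ u _ => hA K t u) (fun K t _ u _ => hB K t u)

include hsh in
/-- **★★ N21's FACE AT THE SAME READING FROM THE ℓ¹ LETTER ON THE COARSE WEIGHTS**: the one-sided ℓ¹ mismatch sums of the COARSE class weights over the coarse class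
set `≤ w K` times the coarse totals at every `K`, `|t| ≤ 1`, `0 ≤ w` summable ⇒ `ShellWeightBound` at `crOfRecord₁₃KAt K₀ kr bd sh⋆`, canonical `Wsh` (dag-n20-d's
`shellWeightBound_crOfRecord₁₃KAt` on module 13's `shellWeightBound_optShell`).  The hypothesis IS the two-run matching content at the coarse key — NOT PRINTED for `d = 4`,
NOT proved. [cite: Balaban1989LargeFieldII, Thm 1 + (0.1) pp.355–356 (one-run template only)] [bookkeeping] -/
theorem shellWeightBound_crOfRecord₁₃KAt_optShell_of_l1MismatchK {w : ℕ → ℝ} (hw0 : ∀ K, 0 ≤ w K) (hws : Summable w)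
    (hmA : ∀ (K : ℕ) (t : ℝ), |t| ≤ 1 →
      ∑ u ∈ classSetK₁₃ θ K₀ g₀ (kr F θ hP g₀ os) K,
          max 0 (weightAK₁₃ θ hP K₀ g₀ os (kr F θ hP g₀ os) K t u - Real.exp (-c K) * weightBK₁₃ θ hP K₀ g₀ os (kr F θ hP g₀ os) K t u)
        ≤ w K * ∑ u ∈ classSetK₁₃ θ K₀ g₀ (kr F θ hP g₀ os) K, weightAK₁₃ θ hP K₀ g₀ os (kr F θ hP g₀ os) K t u)
    (hmB : ∀ (K : ℕ) (t : ℝ), |t| ≤ 1 →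
      ∑ u ∈ classSetK₁₃ θ K₀ g₀ (kr F θ hP g₀ os) K,
          max 0 (weightBK₁₃ θ hP K₀ g₀ os (kr F θ hP g₀ os) K t u - Real.exp (c K) * weightAK₁₃ θ hP K₀ g₀ os (kr F θ hP g₀ os) K t u)
        ≤ w K * ∑ u ∈ classSetK₁₃ θ K₀ g₀ (kr F θ hP g₀ os) K, weightBK₁₃ θ hP K₀ g₀ os (kr F θ hP g₀ os) K t u) :
    ShellWeightBound (crOfRecord₁₃KAt K₀ kr bd sh F θ hP g₀ os).l₀ (crOfRecord₁₃KAt K₀ kr bd sh F θ hP g₀ os).T (crOfRecord₁₃KAt K₀ kr bd sh F θ hP g₀ os).A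
      (crOfRecord₁₃KAt K₀ kr bd sh F θ hP g₀ os).B (crOfRecord₁₃KAt K₀ kr bd sh F θ hP g₀ os).shA (crOfRecord₁₃KAt K₀ kr bd sh F θ hP g₀ os).shB
      (crOfRecord₁₃KAt K₀ kr bd sh F θ hP g₀ os).Wsh := by
  have hA := weightAK₁₃_nonneg_record K₀ kr θ hP g₀ os
  have hB := weightBK₁₃_nonneg_record K₀ kr θ hP g₀ os
  refine shellWeightBound_crOfRecord₁₃KAt K₀ kr bd sh θ hP g₀ os (Wsh := w) ?_
  rw [hsh]
  exact shellWeightBound_optShell (l₀ := 1) (T := classSetK₁₃ θ K₀ g₀ (kr F θ hP g₀ os)) (weightAK₁₃ θ hP K₀ g₀ os (kr F θ hP g₀ os))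
    (weightBK₁₃ θ hP K₀ g₀ os (kr F θ hP g₀ os)) c (fun K t _ u _ => hA K t u) (fun K t _ u _ => hB K t u) hw0 hws hmA hmB

include hsh in
/-- **★★★ N21's FACE AT EVERY KEY READING FROM MODULE 13's LETTER AT THE RECORD's FINE WEIGHTS** — verbatim the hypotheses of module 13's
`shellWeightBound_crOfRecord₁₃VAt_optShell_of_l1Mismatch` (one-sided ℓ¹ mismatch sums of `weightA₁₃ ∕ weightB₁₃` over `classSet₁₃` `≤ w K` times the totals, `0 ≤ w` summable):
then for EVERY `kr` and `bd`, `ShellWeightBound` holds at `crOfRecord₁₃KAt K₀ kr bd sh⋆` (optimal split of the COARSE weights, SAME constants), canonical `Wsh` — ONE letter at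
v5's pin serves the N21 face at every key reading, same `c`, same `w` (§1 descent along `kr F θ hP g₀ os`).  NOT PRINTED for `d = 4`, NOT proved.
[cite: Balaban1989LargeFieldII, Thm 1 + (0.1) pp.355–356, (1.80) p.384 (templates only)] [bookkeeping] -/
theorem shellWeightBound_crOfRecord₁₃KAt_optShell_of_l1Mismatch {w : ℕ → ℝ} (hw0 : ∀ K, 0 ≤ w K) (hws : Summable w)
    (hmA : ∀ (K : ℕ) (t : ℝ), |t| ≤ 1 →
      ∑ x ∈ classSet₁₃ θ K₀ g₀ K, max 0 (weightA₁₃ θ hP K₀ g₀ os K t x - Real.exp (-c K) * weightB₁₃ θ hP K₀ g₀ os K t x)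
        ≤ w K * ∑ x ∈ classSet₁₃ θ K₀ g₀ K, weightA₁₃ θ hP K₀ g₀ os K t x)
    (hmB : ∀ (K : ℕ) (t : ℝ), |t| ≤ 1 →
      ∑ x ∈ classSet₁₃ θ K₀ g₀ K, max 0 (weightB₁₃ θ hP K₀ g₀ os K t x - Real.exp (c K) * weightA₁₃ θ hP K₀ g₀ os K t x)
        ≤ w K * ∑ x ∈ classSet₁₃ θ K₀ g₀ K, weightB₁₃ θ hP K₀ g₀ os K t x) :
    ShellWeightBound (crOfRecord₁₃KAt K₀ kr bd sh F θ hP g₀ os).l₀ (crOfRecord₁₃KAt K₀ kr bd sh F θ hP g₀ os).T (crOfRecord₁₃KAt K₀ kr bd sh F θ hP g₀ os).A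
      (crOfRecord₁₃KAt K₀ kr bd sh F θ hP g₀ os).B (crOfRecord₁₃KAt K₀ kr bd sh F θ hP g₀ os).shA (crOfRecord₁₃KAt K₀ kr bd sh F θ hP g₀ os).shB
      (crOfRecord₁₃KAt K₀ kr bd sh F θ hP g₀ os).Wsh := by
  letI : ∀ Kc, DecidableEq (SiteSeqKey F Kc) := fun _ => Classical.decEq _
  have hmaps : ∀ K, ∀ x ∈ classSet₁₃ θ K₀ g₀ K, kr F θ hP g₀ os K x ∈ classSetK₁₃ θ K₀ g₀ (kr F θ hP g₀ os) K :=
    fun K x hx => kr_mem_classSetK₁₃ θ K₀ g₀ (kr F θ hP g₀ os) hx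
  refine shellWeightBound_crOfRecord₁₃KAt_optShell_of_l1MismatchK K₀ kr bd sh θ hP g₀ os c hsh hw0 hws ?_ ?_
  · intro K t ht
    exact mismatch_classVal_le_of_mismatch_le (S := classSet₁₃ θ K₀ g₀) (π := kr F θ hP g₀ os) (p := weightA₁₃ θ hP K₀ g₀ os)
      (q := weightB₁₃ θ hP K₀ g₀ os) hmaps (hmA K t ht)
  · intro K t ht
    exact mismatch_classVal_le_of_mismatch_le (S := classSet₁₃ θ K₀ g₀) (π := kr F θ hP g₀ os) (p := weightB₁₃ θ hP K₀ g₀ os)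
      (q := weightA₁₃ θ hP K₀ g₀ os) hmaps (hmB K t ht)

/-- **★ RE-KEYING SHRINKS THE OPTIMAL SHELLS AT THE RECORD** (run A; run B is the same with `A ↔ B`, `−c ↔ c`): the optimal shell of the COARSE run-A weight at a coarse
class `u` is at most node U5d's partial sum, over the classes of record reading to `u`, of the fine optimal shells of `weightA₁₃` against `weightB₁₃` (same constant). [bookkeeping] -/
theorem optShellK_le_classVal_optShell (K : ℕ) (t : ℝ) (u : Σ K, SiteSeqKey F (K₀ + K)) :
    max 0 (weightAK₁₃ θ hP K₀ g₀ os (kr F θ hP g₀ os) K t u - Real.exp (-c K) * weightBK₁₃ θ hP K₀ g₀ os (kr F θ hP g₀ os) K t u) ≤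
      letI : ∀ Kc, DecidableEq (SiteSeqKey F Kc) := fun _ => Classical.decEq _
      classVal (classSet₁₃ θ K₀ g₀) (kr F θ hP g₀ os)
        (fun K t x => max 0 (weightA₁₃ θ hP K₀ g₀ os K t x - Real.exp (-c K) * weightB₁₃ θ hP K₀ g₀ os K t x)) K t u := by
  letI : ∀ Kc, DecidableEq (SiteSeqKey F Kc) := fun _ => Classical.decEq _
  exact optShell_classVal_le_classVal_optShell (S := classSet₁₃ θ K₀ g₀) (π := kr F θ hP g₀ os) (weightA₁₃ θ hP K₀ g₀ os) (weightB₁₃ θ hP K₀ g₀ os) _ K t u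

end Record

/-! ## §3 Along dag-n20-d's key-reading TOWERS: composite dials (KTower §1) and the window tower `windowKeyReading₁₃ K₀ c` (KTower §2–§3) -/

section Tower

variable {F : T4Family} {N : ℕ} [NeZero N] (θ : Stage13HParams F N) (hP : θ.Provisos₁₃CoPH F N) (K₀ : ℕ) (g₀ : ℕ → ℝ) (os : List (ULoop F))

/-- **★★★ THE ℓ¹ MATCHING LETTER IS MONOTONE ALONG COMPOSITION OF KEY READINGS**: if at `(K, t)` both one-sided mismatches of the `kr₁`-coarse weights (run A against
`mA·`run B, run B against `mB·`run A) are `≤ w` times the respective totals, then so for the weights read along the COMPOSITE dial `kr₂ ∘ kr₁`, SAME multipliers, SAME `w` —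
KTower's `weightAK₁₃_comp ∕ weightBK₁₃_comp ∕ classSetK₁₃_comp` (the composite carriers are the `kr₁`-carriers re-keyed along `kr₂`) and §1's descent: every further coarsening
(level window, a forgiving window, the trivial key, …) can only CANCEL mismatches inside the classes it merges. [cite: Balaban1989LargeFieldII, (1.80) p.384 (bookkeeping only)] [bookkeeping] -/
theorem mismatch_comp_of_mismatch (kr₁ kr₂ : ℕ → (Σ K, SiteSeqKey F (K₀ + K)) → (Σ K, SiteSeqKey F (K₀ + K))) {mA mB w : ℝ} {K : ℕ} {t : ℝ}
    (hm : (∑ u ∈ classSetK₁₃ θ K₀ g₀ kr₁ K, max 0 (weightAK₁₃ θ hP K₀ g₀ os kr₁ K t u - mA * weightBK₁₃ θ hP K₀ g₀ os kr₁ K t u)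
        ≤ w * ∑ u ∈ classSetK₁₃ θ K₀ g₀ kr₁ K, weightAK₁₃ θ hP K₀ g₀ os kr₁ K t u) ∧
      (∑ u ∈ classSetK₁₃ θ K₀ g₀ kr₁ K, max 0 (weightBK₁₃ θ hP K₀ g₀ os kr₁ K t u - mB * weightAK₁₃ θ hP K₀ g₀ os kr₁ K t u)
        ≤ w * ∑ u ∈ classSetK₁₃ θ K₀ g₀ kr₁ K, weightBK₁₃ θ hP K₀ g₀ os kr₁ K t u)) :
    (∑ u ∈ classSetK₁₃ θ K₀ g₀ (fun K x => kr₂ K (kr₁ K x)) K,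
        max 0 (weightAK₁₃ θ hP K₀ g₀ os (fun K x => kr₂ K (kr₁ K x)) K t u - mA * weightBK₁₃ θ hP K₀ g₀ os (fun K x => kr₂ K (kr₁ K x)) K t u)
      ≤ w * ∑ u ∈ classSetK₁₃ θ K₀ g₀ (fun K x => kr₂ K (kr₁ K x)) K, weightAK₁₃ θ hP K₀ g₀ os (fun K x => kr₂ K (kr₁ K x)) K t u) ∧
    (∑ u ∈ classSetK₁₃ θ K₀ g₀ (fun K x => kr₂ K (kr₁ K x)) K,
        max 0 (weightBK₁₃ θ hP K₀ g₀ os (fun K x => kr₂ K (kr₁ K x)) K t u - mB * weightAK₁₃ θ hP K₀ g₀ os (fun K x => kr₂ K (kr₁ K x)) K t u)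
      ≤ w * ∑ u ∈ classSetK₁₃ θ K₀ g₀ (fun K x => kr₂ K (kr₁ K x)) K, weightBK₁₃ θ hP K₀ g₀ os (fun K x => kr₂ K (kr₁ K x)) K t u) := by
  letI : ∀ Kc, DecidableEq (SiteSeqKey F Kc) := fun _ => Classical.decEq _
  have hmaps : ∀ K, ∀ u ∈ classSetK₁₃ θ K₀ g₀ kr₁ K, kr₂ K u ∈ classSetK₁₃ θ K₀ g₀ (fun K x => kr₂ K (kr₁ K x)) K := by
    intro K u hu
    rw [classSetK₁₃_comp θ K₀ g₀ kr₁ kr₂ K]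
    exact Finset.mem_image_of_mem _ hu
  simp only [weightAK₁₃_comp θ hP K₀ g₀ os kr₁ kr₂, weightBK₁₃_comp θ hP K₀ g₀ os kr₁ kr₂]
  exact ⟨mismatch_classVal_le_of_mismatch_le hmaps hm.1, mismatch_classVal_le_of_mismatch_le hmaps hm.2⟩

/-- **★★★ … AND ALONG THE WINDOW TOWER**: for floors `c ≤ c′` at every step, the two letters at `(K, t)` for the floor-`c` window weights imply the two letters for the
floor-`c′` window weights, SAME multipliers, SAME `w` — KTower's `weightAK₁₃_window_of_le ∕ weightBK₁₃_window_of_le ∕ classSetK₁₃_window_of_le` (floor-`c′` carriers = floor-`c`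
carriers re-keyed along `windowKeySigma c′`) and §1's descent: raising the floor can only cancel mismatches inside the merged classes.  With floor READINGS `cf ≤ cf′` at a
tuple, feeding the two conclusions (at `mA := e^{−c_K}`, `mB := e^{c_K}`, `w := w K`) to §2's `shellWeightBound_crOfRecord₁₃KAt_optShell_of_l1MismatchK` at
`kr := windowKeyReading₁₃ K₀ cf′` gives N21 at the higher window reading from the letter at the lower one (`windowKeyReading₁₃ K₀ cf′ F θ hP g₀ os` unfolds to the dial here).
[cite: Balaban1989LargeFieldII, (1.80) p.384 (bookkeeping only)] [bookkeeping] -/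
theorem mismatch_window_of_le (c c' : ℕ → ℕ) (h : ∀ K, c K ≤ c' K) {mA mB w : ℝ} {K : ℕ} {t : ℝ}
    (hm : (∑ u ∈ classSetK₁₃ θ K₀ g₀ (fun _ x => windowKeySigma F c x) K,
          max 0 (weightAK₁₃ θ hP K₀ g₀ os (fun _ x => windowKeySigma F c x) K t u - mA * weightBK₁₃ θ hP K₀ g₀ os (fun _ x => windowKeySigma F c x) K t u)
        ≤ w * ∑ u ∈ classSetK₁₃ θ K₀ g₀ (fun _ x => windowKeySigma F c x) K, weightAK₁₃ θ hP K₀ g₀ os (fun _ x => windowKeySigma F c x) K t u) ∧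
      (∑ u ∈ classSetK₁₃ θ K₀ g₀ (fun _ x => windowKeySigma F c x) K,
          max 0 (weightBK₁₃ θ hP K₀ g₀ os (fun _ x => windowKeySigma F c x) K t u - mB * weightAK₁₃ θ hP K₀ g₀ os (fun _ x => windowKeySigma F c x) K t u)
        ≤ w * ∑ u ∈ classSetK₁₃ θ K₀ g₀ (fun _ x => windowKeySigma F c x) K, weightBK₁₃ θ hP K₀ g₀ os (fun _ x => windowKeySigma F c x) K t u)) :
    (∑ u ∈ classSetK₁₃ θ K₀ g₀ (fun _ x => windowKeySigma F c' x) K,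
        max 0 (weightAK₁₃ θ hP K₀ g₀ os (fun _ x => windowKeySigma F c' x) K t u - mA * weightBK₁₃ θ hP K₀ g₀ os (fun _ x => windowKeySigma F c' x) K t u)
      ≤ w * ∑ u ∈ classSetK₁₃ θ K₀ g₀ (fun _ x => windowKeySigma F c' x) K, weightAK₁₃ θ hP K₀ g₀ os (fun _ x => windowKeySigma F c' x) K t u) ∧
    (∑ u ∈ classSetK₁₃ θ K₀ g₀ (fun _ x => windowKeySigma F c' x) K,
        max 0 (weightBK₁₃ θ hP K₀ g₀ os (fun _ x => windowKeySigma F c' x) K t u - mB * weightAK₁₃ θ hP K₀ g₀ os (fun _ x => windowKeySigma F c' x) K t u)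
      ≤ w * ∑ u ∈ classSetK₁₃ θ K₀ g₀ (fun _ x => windowKeySigma F c' x) K, weightBK₁₃ θ hP K₀ g₀ os (fun _ x => windowKeySigma F c' x) K t u) := by
  letI : ∀ Kc, DecidableEq (SiteSeqKey F Kc) := fun _ => Classical.decEq _
  have hmaps : ∀ K, ∀ u ∈ classSetK₁₃ θ K₀ g₀ (fun _ x => windowKeySigma F c x) K,
      windowKeySigma F c' u ∈ classSetK₁₃ θ K₀ g₀ (fun _ x => windowKeySigma F c' x) K := by
    intro K u hu
    rw [classSetK₁₃_window_of_le θ K₀ g₀ c c' h K]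
    exact Finset.mem_image_of_mem _ hu
  simp only [weightAK₁₃_window_of_le θ hP K₀ g₀ os c c' h, weightBK₁₃_window_of_le θ hP K₀ g₀ os c c' h]
  exact ⟨mismatch_classVal_le_of_mismatch_le (π := fun _ x => windowKeySigma F c' x) hmaps hm.1,
    mismatch_classVal_le_of_mismatch_le (π := fun _ x => windowKeySigma F c' x) hmaps hm.2⟩

end Tower

end Summit.QuantumFields.YangMills.BalabanUVNodes.N20CoreEdgeShellDialAtKeyReading

end
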